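import Mathlib
import Summits.AtomisticToContinuum.Crystallization.Theses.NashClassCertificates

/-!
# Sketch — crux `NashNearField` (stmt-AtomisticToContinuum-16827), ideator 1, round 1

First lemmas of the line `caccioppoli-cauchy-born-floor` (card `idea-caccioppoli-cauchy-born-floor.md`),
stated as `Prop`s over existing declarations.  Nothing here is proved; everything must elaborate.

* `NashForceBalance`      — Lemma 0 (entry): the crux's inline best-response clause implies exact
                             Lennard-Jones force balance at every particle (Fermat at an interior
                             global minimum of `y ↦ Σ_{j≠i} V |y − x_j|`).  This is the `Equil`
                             predicate consumed by the tree's regularity engine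
                             (`Theorems/ExcessDecayLiouville*`: Caccioppoli, harmonic replacement).
* `AffineImagePeriodic`   — the anchor of the Cauchy–Born floor: the image of a periodic
                             configuration under an invertible linear map is a periodic
                             configuration (so its energy per particle dominates `e* = ⨅ e(Q)` by
                             `ciInf_le` — `AffinePeriodicFloor`).
* `AffineLayeredFloor`    — FIRST LEMMA of the line (the zero-curvature Cauchy–Born floor, word-agnostic):
                             for every invertible linear `A` in the goodness tube and every layered
                             set (ANY Hägg word, box spacings), the site energies of the affine image
                             satisfy `Σ_{p∈Ω}(e_p − e*) ≥ −C·#∂₄Ω` for every finite `Ω` — periodise the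
                             window + layer-cake over the occupation profile; no stacking energetics.
* `LayeredCaccioppoli`    — the regularity engine's first inequality for ALL words: the discrete
                             Caccioppoli (reverse Poincaré) inequality for the LJ force-constant
                             operator of a force-balanced layered reference, under the uniform
                             stability hypothesis of `UniformPolytypeStability` (stmt-15800, inline).
-/

namespace Summit.AtomisticToContinuum.Crystallization.Cruxes.NashNearField.IdeatorOne

open scoped BigOperators
open Literature.MathematicalPhysics.StatisticalMechanics Literature.Geometry.DiscreteGeometry

local notation "E3" => EuclideanSpace ℝ (Fin 3)

/-- The crux's inline NASH clause (best response against every free point), verbatim. -/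
def NashClause {N : ℕ} (x : Fin N → E3) : Prop :=
  ∀ (i : Fin N) (y : E3), (∀ j : Fin N, j ≠ i → y ≠ x j) →
    siteEnergy lennardJones x i ≤ ∑ j ∈ Finset.univ.erase i, lennardJones (dist y (x j))

/-- **Lemma 0 (entry).** Nash + separation ⇒ exact force balance at every particle:
`Σ_{j ≠ i} (V′(r_ij)/r_ij) • (x_i − x_j) = 0`. -/
def NashForceBalance : Prop :=
  ∀ (N : ℕ) (x : Fin N → E3), (∀ i j : Fin N, i ≠ j → 1 / 3 ≤ dist (x i) (x j)) → NashClause x →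
    ∀ i : Fin N,
      ∑ j ∈ Finset.univ.erase i,
        (deriv lennardJones (dist (x i) (x j)) / dist (x i) (x j)) • (x i - x j) = (0 : E3)

/-- **Anchor.** The image of a periodic configuration of `ℝ³` under an invertible (continuous) linear
map is again a periodic configuration with the image point set. -/
def AffineImagePeriodic : Prop :=
  ∀ (P : PeriodicConfiguration 3) (A : E3 ≃L[ℝ] E3),
    ∃ Q : PeriodicConfiguration 3, Q.points = A '' P.points

/-- Consequently the energy per particle of every affine image of every periodic configuration
dominates `e* = ⨅_Q e(Q)` — "affine is periodic, periodic ≥ e* by definition". -/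
def AffinePeriodicFloor : Prop :=
  ∀ (P : PeriodicConfiguration 3) (A : E3 ≃L[ℝ] E3),
    ∃ Q : PeriodicConfiguration 3, Q.points = A '' P.points ∧
      (⨅ R : PeriodicConfiguration 3, R.energyPerParticle lennardJones) ≤
        Q.energyPerParticle lennardJones

/-- **FIRST LEMMA — the zero-curvature Cauchy–Born floor (word-agnostic).**  There is `C` such that
for every invertible linear `A` within `1/20` of a linear isometry, every in-layer spacing
`a ∈ [47/50, 1]`, every Hägg word `s` and every height sequence `z` with increments in
`[39a/50, 17a/20]`, writing `S` for the affine image under `A` of the layered set and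
`e_p = ½ Σ'_{q ∈ S, q ≠ p} V_LJ |p − q|` for its site energies, every finite `Ω ⊆ S` satisfies
`−C · #{p ∈ Ω : ∃ q ∈ S ∖ Ω, |q − p| ≤ 4} ≤ Σ_{p ∈ Ω} (e_p − e*)`. -/
def AffineLayeredFloor : Prop :=
  ∃ C : ℝ, ∀ (A : E3 ≃L[ℝ] E3),
    (∃ R : E3 ≃ₗᵢ[ℝ] E3, ‖(A : E3 →L[ℝ] E3) - (R.toContinuousLinearEquiv : E3 →L[ℝ] E3)‖ ≤ 1 / 20) →
    ∀ (a : ℝ) (s : ℤ → ℤ) (z : ℤ → ℝ), 47 / 50 ≤ a → a ≤ 1 → IsHaggSeq s →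
      (∀ m : ℤ, 39 / 50 * a ≤ z (m + 1) - z m ∧ z (m + 1) - z m ≤ 17 / 20 * a) →
      let S : Set E3 := {p | ∃ m i j : ℤ, p = A (((i : ℝ) • triangularVec₁ a) + ((j : ℝ) • triangularVec₂ a) +
        ((haggLabel s m : ℝ) • barlowOffset a) + (z m • layerNormal 1))}
      ∀ Ω : Finset E3, (↑Ω : Set E3) ⊆ S →
        -(C * (Nat.card {p : E3 // p ∈ Ω ∧ ∃ q ∈ S, q ∉ Ω ∧ dist q p ≤ 4} : ℝ)) ≤
          ∑ p ∈ Ω, ((1 / 2 : ℝ) * (∑' q : {q : E3 // q ∈ S ∧ q ≠ p}, lennardJones (dist p q.1)) -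
            (⨅ Q : PeriodicConfiguration 3, Q.energyPerParticle lennardJones))

/-- **Regularity engine, first inequality — discrete Caccioppoli for every word (commutator form).**  Under the
uniform harmonic stability of force-balanced layered sets (the statement of `UniformPolytypeStability`, stmt-15800,
taken inline as the first hypothesis with its constant `κ`), a displacement `h` bounded on the sites and HARMONIC for
the LJ force-constant operator at every site of the open ball `B(c, 2ρ)` satisfies, for the radial cutoff
`η = max 0 (min 1 (2 − dist/ρ))` (equal to `1` on `B(c, ρ)`, supported in `B(c, 2ρ)`, slope `1/ρ`):
`κ · NN(η•h) ≤ ½ Σ'Σ' (η p − η q)² ⟪K(p−q) h p, h q⟫` — exactly the shape of the tree's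
`caccioppoli_inequality` (hcp datum), now for every Hägg word; since `|K(e)| = O(|e|⁻⁸)` the right side is
`O(ρ⁻²)` times a weighted mass of `h`, i.e. curvature is paid by displacement one scale up (and, applied to in-plane
difference quotients `h = D_τ u`, by strain oscillation). -/
def LayeredCaccioppoli : Prop :=
  let Hess : E3 → E3 → ℝ := fun e w => deriv (deriv lennardJones) ‖e‖ * (inner ℝ e w / ‖e‖) ^ 2 +
    deriv lennardJones ‖e‖ / ‖e‖ * (‖w‖ ^ 2 - (inner ℝ e w / ‖e‖) ^ 2)
  let K : E3 → E3 → E3 := fun e w => (deriv (deriv lennardJones) ‖e‖ * (inner ℝ e w / ‖e‖) / ‖e‖) • e +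
    (deriv lennardJones ‖e‖ / ‖e‖) • (w - (inner ℝ e w / ‖e‖ / ‖e‖) • e)
  ∀ κ : ℝ, 0 < κ →
    (∀ (a : ℝ) (s : ℤ → ℤ) (z : ℤ → ℝ), 47 / 50 ≤ a → a ≤ 1 → IsHaggSeq s →
      (∀ m : ℤ, 39 / 50 * a ≤ z (m + 1) - z m ∧ z (m + 1) - z m ≤ 17 / 20 * a) →
      let Sites : Set E3 := {p | ∃ m i j : ℤ, p = ((i : ℝ) • triangularVec₁ a) + ((j : ℝ) • triangularVec₂ a) +
        ((haggLabel s m : ℝ) • barlowOffset a) + (z m • layerNormal 1)}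
      (∀ p ∈ Sites, HasSum (fun q : {q : E3 // q ∈ Sites ∧ q ≠ p} =>
        (deriv lennardJones (dist p q.1) / dist p q.1) • (p - q.1)) 0) →
      ∀ u : E3 → E3, (Function.support u).Finite → Function.support u ⊆ Sites →
        κ * (∑' p : Sites, ∑' q : Sites, if dist (p : E3) q ≤ 11 / 10 then ‖u p - u q‖ ^ 2 else 0) ≤
          (∑' p : Sites, ∑' q : Sites, if (p : E3) ≠ q then Hess ((p : E3) - q) (u p - u q) else 0) / 2) →
    ∀ (a : ℝ) (s : ℤ → ℤ) (z : ℤ → ℝ), 47 / 50 ≤ a → a ≤ 1 → IsHaggSeq s →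
      (∀ m : ℤ, 39 / 50 * a ≤ z (m + 1) - z m ∧ z (m + 1) - z m ≤ 17 / 20 * a) →
      let Sites : Set E3 := {p | ∃ m i j : ℤ, p = ((i : ℝ) • triangularVec₁ a) + ((j : ℝ) • triangularVec₂ a) +
        ((haggLabel s m : ℝ) • barlowOffset a) + (z m • layerNormal 1)}
      (∀ p ∈ Sites, HasSum (fun q : {q : E3 // q ∈ Sites ∧ q ≠ p} =>
        (deriv lennardJones (dist p q.1) / dist p q.1) • (p - q.1)) 0) →
      ∀ (c : E3) (ρ : ℝ), 1 ≤ ρ → ∀ (h : E3 → E3) (B : ℝ), (∀ p ∈ Sites, ‖h p‖ ≤ B) →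
        (∀ p ∈ Sites, dist p c < 2 * ρ →
          HasSum (fun q : {q : E3 // q ∈ Sites ∧ q ≠ p} => K (p - q.1) (h p - h q.1)) 0) →
        let η : E3 → ℝ := fun p => max 0 (min 1 (2 - dist p c / ρ))
        κ * (∑' p : Sites, ∑' q : Sites,
              if dist (p : E3) q ≤ 11 / 10 then ‖η p • h p - η q • h q‖ ^ 2 else 0) ≤
          (1 / 2) * ∑' p : Sites, ∑' q : Sites,
            if (p : E3) ≠ q then (η p - η q) ^ 2 * inner ℝ (K ((p : E3) - q) (h p)) (h q) else 0

/-! ## Card 2 (`tangent-liouville-paying-blocks`): the Liouville transfer and its compactness shadow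

The conclusion is a GENERALISED STACK: identical, equally oriented triangular layers (spacing `a`), deformed by
ONE invertible linear map, with ARBITRARY per-layer in-plane offsets `(c₁ m, c₂ m)` (registry thirds PLUS the
internal sublattice shifts that strained non-centrosymmetric stackings carry at equilibrium — hcp has non-zero
inner-displacement tensors, so exact hole registry would make the statement false for sheared hcp) and free
heights `z m`.  Goodness then pins the offsets near hole positions and the spacings near `a√(2/3)`; the energy of
off-registry offsets is part of `LandscapeCoercivity`. -/

/-- **BARLOW–LIOUVILLE (card 2's C⁺).** Every non-empty `1/3`-separated subset of `ℝ³` all of whose points are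
`1/20`-good (two-shell fcc/hcp environments at scales in `[47/50, 1]`, the crux's predicate in its `Set` form) and
which is in exact Lennard-Jones force balance at every point is an affine image of a generalised stack of identical
triangular layers: entire + defect-free + equilibrium ⇒ no in-plane modulation, one orientation and one lattice for
all layers, flat layers (offsets and heights stay free). -/
def BarlowLiouville : Prop :=
  ∀ X : Set E3, X.Nonempty → (∀ p ∈ X, ∀ q ∈ X, p ≠ q → 1 / 3 ≤ dist p q) →
    (∀ p ∈ X, IsTwoShellGoodSet (1 / 20) (47 / 50) 1 X p) →
    (∀ p ∈ X, HasSum (fun q : {q : E3 // q ∈ X ∧ q ≠ p} =>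
      (deriv lennardJones (dist p q.1) / dist p q.1) • (p - q.1)) 0) →
    ∃ (A : E3 ≃L[ℝ] E3) (t : E3) (a : ℝ) (c₁ c₂ z : ℤ → ℝ),
      (∃ R : E3 ≃ₗᵢ[ℝ] E3, ‖(A : E3 →L[ℝ] E3) - (R.toContinuousLinearEquiv : E3 →L[ℝ] E3)‖ ≤ 1 / 5) ∧
      47 / 50 ≤ a ∧ a ≤ 1 ∧ StrictMono z ∧
      X = {p | ∃ m i j : ℤ, p = t + A ((((i : ℝ) + c₁ m) • triangularVec₁ a) + (((j : ℝ) + c₂ m) • triangularVec₂ a) +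
        (z m • layerNormal 1))}

/-- **DEEP FLATNESS (the compactness shadow of `BarlowLiouville`, in the crux's vocabulary).**  For every
tolerance `ε > 0` and radius `R` there is a depth `L` such that in every `1/3`-separated NASH configuration, every
particle all of whose neighbours within distance `L` are `1/20`-good has its radius-`R` ball two-way `ε`-matched,
after a translation, with an affine image (within `1/5` of an isometry) of a generalised stack. -/
def DeepFlatness : Prop :=
  ∀ ε : ℝ, 0 < ε → ∀ R : ℝ, ∃ L : ℝ, ∀ (N : ℕ) (x : Fin N → E3),
    (∀ i j : Fin N, i ≠ j → 1 / 3 ≤ dist (x i) (x j)) → NashClause x →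
    ∀ i : Fin N, (∀ j : Fin N, dist (x j) (x i) ≤ L → IsTwoShellGood (1 / 20) (47 / 50) 1 x j) →
      ∃ (A : E3 ≃L[ℝ] E3) (t : E3) (a : ℝ) (c₁ c₂ z : ℤ → ℝ),
        (∃ R' : E3 ≃ₗᵢ[ℝ] E3, ‖(A : E3 →L[ℝ] E3) - (R'.toContinuousLinearEquiv : E3 →L[ℝ] E3)‖ ≤ 1 / 5) ∧
        47 / 50 ≤ a ∧ a ≤ 1 ∧ StrictMono z ∧
        let S : Set E3 := {p | ∃ m i j : ℤ, p = A ((((i : ℝ) + c₁ m) • triangularVec₁ a) +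
          (((j : ℝ) + c₂ m) • triangularVec₂ a) + (z m • layerNormal 1))}
        (∀ j : Fin N, dist (x j) (x i) ≤ R → ∃ p ∈ S, dist (x j + t) p ≤ ε) ∧
        (∀ p ∈ S, dist p (x i + t) ≤ R → ∃ j : Fin N, dist (x j + t) p ≤ ε)

end Summit.AtomisticToContinuum.Crystallization.Cruxes.NashNearField.IdeatorOne
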